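import Summits.HodgeConjecture.HodgeConjecture.Theorems.EndoscopicMiddleDegreeMiddleThetaSpanHeckeIdempotents
import Summits.HodgeConjecture.HodgeConjecture.Theorems.EndoscopicMiddleDegreeMiddleThetaSpanSieve

/-!
# Line `conjugate-dimension-sieve` for crux `EndoscopicMiddleDegree.MiddleThetaSpan` (stmt-HodgeConjecture-13661)

INTEGRATION (lead prover-line-stmt-HodgeConjecture-13661-1, re-seat pass 2026-08-16). Two of the six registered stubs are
LANDED and are now imported instead of sorried: `stub_heckeIdempotents` (p80090) and `stub_sieve` (p85055/p96343); the
vocabulary lives in the first of those files. Open: `stub_lefschetzSplit` (blocked: needs a Hecke-invariant hard-Lefschetz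
datum for `c₁(K_X)`, absent), `stub_heckeHodgeType` (blocked: Hodge-type stability of `HeckeDatum.op`, the covers carry no
complex structure), `stub_coreVanishing` (HC-implied bet, tool-less), and `stub_singletonSpan` — FALSE on paper at m = 1
(ε-negative GL₂-CAP Tate pieces outside `typedSpan`: Disproof.lean F12, negative lemma p80039
`MiddleThetaSpan_false_of_epsNegativeCapWitness`, Lines/conjugate-dimension-sieve-dead.md). The line is DEAD; this file is
kept as the registered record (4 sorries) of what the composition needs.


Skeleton (crux-plan, planner-cruxplan-stmt-HodgeConjecture-13661-conjugate-dimension--0, 2026-08-16) of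
idea card `Cruxes/MiddleThetaSpan/Ideas/conjugate-dimension-sieve.md` (crux-ideate r1 ideator 1; triage
r1-1: **pass**, with the sharpening "the core enumeration is wrong — even constituents can own the middle
coordinate; state CoreVanishing for Ψ₅-, Ψ₄-, Ψ₃-, Ψ₂-cores and as a BET", both built in below).

THE CRUX (verbatim, rank 2, THE HEART of route EndoscopicMiddleDegree): for `m ∈ {1,2}`, `n = m+1`,
`D : UnitaryBallQuotientDatum (2n) X` (`X(ℂ) ≅ Γ\𝔹²ⁿ`, `Γ ⊂ U(V)(F)`, `dim_E V = 2n+1`) every RATIONAL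
class `c ∈ H²ⁿ(X(ℂ); ℂ)` of Hodge type `(n,n)` lies in the typed span
`SCⁿ(D) ⊔ span{SCⁿ⁻¹(D) ∪ N¹} ⊔ span{Hdg^{n-1,n-1}_ℚ ∪ N¹}` (`typedSpan m X D`, definitionally the
crux's right-hand side: `middleThetaSpan_iff` is `Iff.rfl`).

THE LINE (Pohlmann's CM criterion transplanted to Hecke-isotypic pieces; AH-free). Write
`H := H²ⁿ(X(ℂ); ℂ)`, `P := ker(· ∪ ℓ) ⊆ H` the primitive part for a Hecke-invariant Lefschetz class
`ℓ` (intended: `c₁(K_X)`, ample on a ball quotient), and let `𝓗 ⊆ End_ℂ H` be the ℂ-algebra generated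
by the CLASSICAL HECKE OPERATORS `T_g = τ ∘ q_g^*` of `g ∈ U(V)(F)` (`HeckeDatum`: the Hecke
correspondence of `g` presented on a finite regular cover `N\𝔹 → Γ\𝔹 = X(ℂ)`, `N ≤ Γ ∩ g⁻¹Γg`, with
the tree's transfer `FiniteDeckCover.transferMap`; the presentation is PINNED by the uniformization
`D.unif`, so `heckeAlgebra D k` is a genuine definition, not a hypothesis structure). The pieces of the
line are the images `e(P)` of the primitive central idempotents `e` of `𝓗` (= the `π_f`-isotypic
components of the primitive middle cohomology, Matsushima; `e ↔ π_f` up to twist-class on the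
component `Γ\𝔹`), and `σ ∈ Aut(ℂ)` acts on `H = H²ⁿ(X(ℂ); ℚ) ⊗ ℂ` through the coefficients
(`conjAct`, the tree's `singularCohomology.ringChange σ`), permuting the pieces: `e ↦ e^σ`
(`IsConjugate`). Every piece is of exactly one of three kinds (pure logic):
(T) TATE TYPE — `e(P)` and every conjugate `e^σ(P)` are purely of type `(n,n)` (`IsTateType`;
    automorphically: `Σ(σπ_f) = {A(n,n)}` for all `σ`, the sign-selected singleton pieces);
(K) KILLED — some conjugate `e^σ(P)` (possibly `e(P)` itself) carries no non-zero `(n,n)`-class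
    (`IsKilledType`; automorphically: a singleton at `π_f` whose character `χ₀` is not parallel);
(C) CORE — neither (`IsCoreType`; automatically every conjugate carries an `(n,n)`-class and some
    conjugate also another type; by Arthur's multiplicity formula + `stub_sieve` (b) these are exactly
    the `π_f` whose parameter has a constituent of dimension `d ≥ 2` owning the middle `τ₁`-coordinate
    at every real place — the triage-corrected core list Ψ₅ (stable), Ψ₄ ∋ 0, 3+2, 3+1+1, Ψ₂ ∋ 0).
* `stub_lefschetzSplit` (KNOWN, Hodge theory): a Hecke-invariant rational algebraic Lefschetz class `ℓ`
  exists and every rational `(n,n)`-class is `c = c₀ + a ∪ ℓ`, `c₀ ∈ P` rational `(n,n)`, `a` rational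
  `(n-1,n-1)` — so `a ∪ ℓ` is in the THIRD typed summand outright.
* `stub_heckeIdempotents` + `stub_heckeHodgeType` (KNOWN in print, Matsushima + BMM Thm 61; lead's
  reshape 2026-08-16 of the planner's `stub_heckePieces`, dropping its unused semisimplicity and
  `P`-stability conjuncts): `𝓗` has a finite complete family of primitive central idempotents, and
  preserves Hodge type `(n,n)`.
* `stub_sieve` (THE LEVER, provable now: naturality of transfer/pull-back in the coefficients + linear
  algebra): conjugates `e^σ` of primitive central idempotents exist and are primitive central; for a
  RATIONAL class `c`, `e c = 0 ↔ e^σ c = 0` (fact (a) of the card); `dim e(P) = dim e^σ(P)` (fact (b)).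
* `stub_singletonSpan` (BET 1, the theta half; idea `definite-twin-theta`): a Tate-type piece lies in
  the typed span.
* `stub_coreVanishing` (BET 2, the honest residue; idea `lefschetz-one-rank-down` covers the 3+1+1
  Ψ₃-cores): a core piece carries no component of a rational primitive `(n,n)`-class.
* `MiddleThetaSpan_of` — the kernel-checked composition: split `c = c₀ + a ∪ ℓ`; `c₀ = Σ_{e ∈ s} e c₀`
  (`stub_heckeIdempotents`); per `e`: (T) ⇒ `e c₀ ∈ e(P) ⊆ span`; (K) ⇒ `e^σ c₀` is an `(n,n)`-class in a killed piece, hence `0`,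
  hence `e c₀ = 0` by the sieve; (C) ⇒ `e c₀ = 0` by CoreVanishing; and `a ∪ ℓ ∈` third summand.

WHAT THE SIEVE BUYS (why this is not the route's expected proof): the kill of (K) and the reduction of
the crux to (T)-span + (C)-vanishing use NO absolute-Hodge / Tate hypothesis (crux
`BallQuotientHodgeAbsolute`, stmt-14348, is bypassed): rationality is consumed exactly once, in
`stub_sieve` (a) (`σ` fixes rational classes), through COEFFICIENT conjugation of Betti cohomology —
never through conjugation of the variety or of de Rham cohomology.

Disproof.lean: NONE exists for this crux at planning time (payload `disproof_path`
run/sessions/refuter-cdisprove-stmt-HodgeConjecture-13661-0/folder/Disproof.lean is absent on this hub;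
`ledger crux ls stmt-HodgeConjecture-13661` lists Ideas/ and TRIAGE-r1-1.md only; no
`Theorems/MiddleThetaSpan/Negative/*` lemma has landed), so no `_false_without_<H>` obstruction is on
record. Honoured instead: the refuter crux-attack (ATTACK.md, 2026-08-15T20:16Z) — the mutation "drop
`IsRationalClass` ⟹ presumably false" is respected (`stub_sieve` (a) and `stub_coreVanishing` are
stated for rational classes only; the line USES rationality, at `stub_sieve`), and its risk R1
(per-level spanning) is carried by `stub_singletonSpan` verbatim. Negatives index (`ledger negatives
--problem HodgeConjecture`, 2 refuted: ELineTransport 22×22 matrix identity stmt-12555, Fermat-K3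
multiset exhaustion stmt-11121): unrelated shapes; no stub is an instance of either.
-/

noncomputable section

namespace Summit.HodgeConjecture.HodgeConjecture.Cruxes.MiddleThetaSpan.ConjugateDimensionSieve

open scoped BigOperators
open Literature.AlgebraicGeometry.Motives (SchemeOver ComplexPoints)
open Literature.AlgebraicGeometry.HodgeTheory
open Literature.AlgebraicGeometry.ShimuraVarieties
open Literature.AlgebraicTopology.SingularHomology
open Summit.HodgeConjecture.HodgeConjecture.Theses.EndoscopicMiddleDegree

set_option linter.unusedVariables false
set_option linter.dupNamespace false

-- VOCABULARY (HeckeDatum, heckeAlgebra, IsPrimitiveCentralIdempotent, conjAct, IsConjugate, primitivePart,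
-- IsHeckeLefschetzClass, typedSpan, middleThetaSpan_iff, IsTateType/IsKilledType/IsCoreType): LANDED verbatim in
-- `Theorems/EndoscopicMiddleDegreeMiddleThetaSpanHeckeIdempotents.lean` (p80090, ACCEPTED) and imported above
-- (integration by lead prover-line-stmt-HodgeConjecture-13661-1, 2026-08-16; the skeleton no longer carries a copy).


/-! ## The stubs -/

/-- **Stub 1 — Lefschetz split off the primitive part (KNOWN; Hodge theory).** For `m ∈ {1,2}` and a
datum `D` there is a Hecke-invariant rational algebraic Lefschetz class `ℓ ∈ H²(X(ℂ); ℂ)` such that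
every rational class `c` of type `(m+1,m+1)` in the middle degree splits as `c = c₀ + a ∪ ℓ` with `c₀`
rational of type `(m+1,m+1)` and PRIMITIVE (`c₀ ∪ ℓ = 0`) and `a ∈ H^{2m}` rational of type `(m,m)`.
Why plausibly true: take `ℓ = c₁(K_X)` — `K_X` is ample on a compact ball quotient (the Bergman =
invariant Kähler form represents a multiple of `c₁(K)`), so `ℓ` is rational, a divisor class (a multiple
is very ample; `N¹` is a ℂ-subspace), and `q^*ℓ = cov^*ℓ = c₁(K_E)` for every Hecke datum (both maps are
local biholomorphisms `N\𝔹 → Γ\𝔹`); hard Lefschetz for `L = ℓ ∪ ·` (Voisin I Thm 6.25: `L² : H²ⁿ⁻² ≅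
H²ⁿ⁺²` on the `2n`-fold) gives `c' := (L²)⁻¹(L c)`, `c₀ := c - L c'`; `L` is of bidegree `(1,1)` and
defined over ℚ (Rem 6.27, §7.1.2), so `c'` is rational of type `(m,m)` and `c₀` rational of type
`(m+1,m+1)` (the tree records exactly these descent clauses in `HardLefschetzNFold`:
`isRationalClass_L_iff`, `isOfHodgeType_L_iff` at `k + j = dim`). Size M given hard Lefschetz for the
class `c₁(K_X)` (itself the named fact `nonempty_hardLefschetzNFold`, whose `h` is an unspecified ample
class — the Hecke-invariance clause is why `c₁(K_X)` specifically is wanted). Leans on: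
`HardLefschetzNFold`, `lefschetzPowTo`, `IsRationalClass.cup`, `cupProduct`, `algebraicClasses`,
`KaehlerClassHodgeType`. -/
theorem stub_lefschetzSplit :
    ∀ (m : ℕ) (X : SchemeOver ℂ) (D : UnitaryBallQuotientDatum (2 * (m + 1)) X), 1 ≤ m → m ≤ 2 →
      ∃ ℓ : complexBetti X (2 * 1), IsHeckeLefschetzClass D m ℓ ∧
        ∀ c : complexBetti X (2 * (m + 1)), IsRationalClass c →
          IsOfHodgeType (2 * (m + 1)) X (2 * (m + 1)) (m + 1) (m + 1) c →
          ∃ (c₀ : complexBetti X (2 * (m + 1))) (a : complexBetti X (2 * m)),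
            IsRationalClass c₀ ∧ IsOfHodgeType (2 * (m + 1)) X (2 * (m + 1)) (m + 1) (m + 1) c₀ ∧
            c₀ ∈ primitivePart ℓ m ∧
            IsRationalClass a ∧ IsOfHodgeType (2 * (m + 1)) X (2 * m) m m a ∧
            c = c₀ + cupProduct (Literature.AlgebraicGeometry.HodgeTheory.two_mul_add_two_mul m 1) a ℓ := by
  sorry

-- **Stub 2a — `stub_heckeIdempotents`: LANDED** (p80090, ACCEPTED, `--supports stmt-HodgeConjecture-13661`) in
-- `Theorems/EndoscopicMiddleDegreeMiddleThetaSpanHeckeIdempotents.lean`; used below by name through the import.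

/-- **Stub 2b — the Hecke algebra preserves the Hodge type `(n,n)` (KNOWN: BMM Thm 61, "`ℋ_K` acts
by algebraic correspondences"; Shimura 1971 Ch. 7).** For `m ∈ {1,2}` and a datum `D`, every element
of `heckeAlgebra D (2n)` maps classes of Hodge type `(n,n)` to classes of Hodge type `(n,n)`.
Why true: a generator `Δ.op = τ ∘ q^*` is pull-back along the local biholomorphism `q : N\𝔹 → Γ\𝔹`
(`q ∘ u = unif ∘ g`, both uniformisations holomorphic: datum field `differentiableOn_unif`) followed by
the trace of the local biholomorphism `cov`; pull-back and trace of harmonic / closed `(p,q)`-forms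
preserve type, and the de Rham comparison of a Hodge model is natural (`HodgeModel.deRham_isNatural`);
sums and composites then preserve the `∃`-over-models predicate `IsOfHodgeType` modulo the model
independence of `H^{p,q}` (`hodgePQ_independent_of_hodgeModel`, natural automorphisms of `Hᵏ(-;ℂ)`
are scalars). Size L–XL in Lean (the cover `E` of a `HeckeDatum` carries no complex structure; it must
be transported from the cone through `u`). Leans on: `HodgeModel`, `IsOfHodgeType`, `HeckeDatum`,
`FiniteDeckCover.transferMap`, `singularCohomology.map`, `Algebra.adjoin_induction`. -/
theorem stub_heckeHodgeType :
    ∀ (m : ℕ) (X : SchemeOver ℂ) (D : UnitaryBallQuotientDatum (2 * (m + 1)) X), 1 ≤ m → m ≤ 2 →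
      ∀ a ∈ heckeAlgebra D (2 * (m + 1)), ∀ c : complexBetti X (2 * (m + 1)),
        IsOfHodgeType (2 * (m + 1)) X (2 * (m + 1)) (m + 1) (m + 1) c →
          IsOfHodgeType (2 * (m + 1)) X (2 * (m + 1)) (m + 1) (m + 1) (a c) := by
  sorry

-- **Stub 3 — `stub_sieve` (THE SIEVE): LANDED** (p85055 by prover-pitem-stmt-HodgeConjecture-14613-1 `--supports 14613`,
-- byte-identical with the registered stub; p96343 `--supports stmt-HodgeConjecture-13661`, ACCEPTED, appends the
-- Aut(ℂ)-orbit lemmas) in `Theorems/EndoscopicMiddleDegreeMiddleThetaSpanSieve.lean`; used below by name through the import.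

/-- **Stub 4 — SINGLETON SPAN (BET 1: the theta half of the heart).** For `m ∈ {1,2}`, a datum `D`, a
Hecke-invariant Lefschetz class `ℓ` and a primitive central idempotent `e` of the Hecke algebra of TATE
TYPE (its primitive piece and all conjugate pieces purely `(n,n)`, `n = m+1`): `e(P) ⊆ typedSpan`.
Automorphic content: `e(P) = ⊕ H²ⁿ(𝔤,K; A(n,n)) ⊗ π_f^K` over a twist-class of `π_f` with
`Σ(σπ_f) = {A(n,n)}` for all `σ`; by Arthur–Mok/KMSW the parameter is `Ψ' ⊞ χ₀` with `χ₀` a character at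
the middle position at EVERY real place, hence parallel; then (idea `definite-twin-theta`, triage pass):
twin `π'_f` on the definite inner form `U(V')`, `θ_{V'→W}` in the first-term range (Rallis,
Kudla–Rallis, Gan–Takeda, Yamana), return `θ_{W→V}` in Weil's convergent range (`V` anisotropic) landing
on `A(n,n) ⊗ π_f` WITH the Kudla–Millson vector, and BMM steps 1–3 (Thm 69/71 seesaw `W = W₁ ⊕ W₂`,
range-free) put the piece in `SCⁿ + SCⁿ⁻¹·N¹ +` Lefschetz; `H^{1,1}` and `H^{n-1,n-1}` are defined over ℚ
for `n ≤ 3` (BMM Cor 62), which is why `m ≤ 2`. Equivalently the route's direct `a = 1` criterion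
(GlobalCriterion: pole of `L^S(s, π × χ₀⁻¹)` at `s = 1` ⟹ `θ_{V→W}(π) ≠ 0`, the same first-term range).
Why it might fail: (R1, refuter ATTACK.md §4 / CAVEAT-13661) PER-LEVEL spanning — the crux is at fixed
level `Γ`: the auxiliary `U(W₂″)`-divisors with non-zero seesaw pairing must exist AT LEVEL `Γ`
(push-forward from a finite cover is not a product `s ∪ d`); CAP singleton shapes (`μ⊠R₂ ⊞ χ₀`,
`η⊠R₂ ⊞ η′⊠R₂ ⊞ χ₀`) need Adams–Johnson/AMR packets where labels are not injective (triage: scope the twin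
to generic `ψ` first); early theta occurrence at `𝔮`. Size XL (paper mathematics until cohomological
representations / theta lifts are typed). Leans on (print): BMM arXiv:1306.1515 Thm 4, 61, 62, 67, 69,
71, 72, Prop 80–81; Kudla–Millson 1990; GQT arXiv:1207.4709 §1.7–1.10, Thm 2; Yamana Invent. 196
(2014); Mok arXiv:1206.0882 / KMSW arXiv:1409.3731; AMR arXiv:1507.01432; Sun–Zhu (conservation);
A. Paul 1998/2000 (archimedean theta); tree: `specialCycleClasses_def`, `specialCycleClasses_le_algebraicClasses`,
`classesSupportedOn`, `CorrespondenceAction`. -/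
theorem stub_singletonSpan :
    ∀ (m : ℕ) (X : SchemeOver ℂ) (D : UnitaryBallQuotientDatum (2 * (m + 1)) X), 1 ≤ m → m ≤ 2 →
      ∀ ℓ : complexBetti X (2 * 1), IsHeckeLefschetzClass D m ℓ →
        ∀ e : Module.End ℂ (complexBetti X (2 * (m + 1))),
          IsPrimitiveCentralIdempotent (heckeAlgebra D (2 * (m + 1))) e → IsTateType D ℓ m e →
            (primitivePart ℓ m).map e ≤ typedSpan m X D := by
  sorry

/-- **Stub 5 — CORE VANISHING (BET 2: the honest residue of the heart; HARDEST).** For `m ∈ {1,2}`, a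
datum `D`, a Hecke-invariant Lefschetz class `ℓ` and a primitive central idempotent `e` of CORE type
(neither Tate type nor killed), every rational primitive `(n,n)`-class `c` has `e c = 0`: core pieces
carry no component of a rational Hodge class.
Why plausibly true: by `stub_sieve` (b) + multiplicity one the conjugates `σπ_f` of a core all have
`|Σ(σπ_f)| = d ≥ 2` with `A(n,n) ∈ Σ`: a constituent `Ψ_d` (`d ∈ {2,3,4,5}` at `p = 4`; `≤ 7` at `p = 6`)
of the parameter owns the middle coordinate at every real place, and the `T`-Hodge structure
`N = (e(P) ⊕ conjugates)_ℚ` (`T` = Hecke field) has `d` distinct Hodge types in each embedding. A rational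
`(n,n)`-class with `e c ≠ 0` would generate a `T`-sub-Hodge structure of `N` of `T`-rank 1 purely of type
`(n,n)`; so the stub FOLLOWS from the `T`-irreducibility of the Hodge structure `N` (Mumford–Tate side),
whose Galois analogue — irreducibility of `r(Ψ_d)` — is known in the relevant cases (rank 3:
Blasius–Rogawski; regular algebraic, `n ≤ 5`: Calegari–Gee arXiv:1104.4827, Xia arXiv:1708.00921; density
one: Patrikis–Taylor arXiv:1307.1640), and "Hodge ⟹ Tate" for these motives alone would also finish it
(absolute Hodge for `N` only — far less than crux BallQuotientHodgeAbsolute). Special cycles and divisor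
products have zero component in cores (theta-type parameters are `Ψ_W ⊞ χ`, Galois-invariance of
cycle classes), consistent with the crux. Partial tool: idea `lefschetz-one-rank-down` (triage: live
for 3+1+1 Ψ₃-cores of type `(1,0,-1)` at every real place — Ichino–Prasanna-type `T`-linear transporter
to `H²` of a Picard modular surface, where Lefschetz (1,1) + irreducibility of `r(Ψ₃)(1)` exclude
rational classes; the transporter must be an ISOMORPHISM, two non-vanishing periods). Why it might fail:
ONE rational `(2,2)`-class in ONE core piece of ONE compact `U(4,1)`-quotient refutes it (route kill
criterion (i); most likely from an EVEN core, 4+1 with Ψ₄ ∋ 0, which no theta construction reaches);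
tool-less today for Ψ₅/Ψ₄/Ψ₂-cores and 3+2. Size: open-problem-sized (XL+). Leans on (print): Arthur's
multiplicity formula (Mok/KMSW), Clozel Ann Arbor Thm 3.13 (conjugates of regular algebraic `Π`),
Kottwitz JAMS 5 / Kisin–Shin–Zhu arXiv:2110.05381 (Galois action on `H²ⁿ[π_f]`), the irreducibility
results above, Ichino–Prasanna arXiv:1806.10563; tree: `IsAbsoluteHodgeClass` (NOT used),
`Motives.HodgeStructure`, `hodgeClasses`. -/
theorem stub_coreVanishing :
    ∀ (m : ℕ) (X : SchemeOver ℂ) (D : UnitaryBallQuotientDatum (2 * (m + 1)) X), 1 ≤ m → m ≤ 2 →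
      ∀ ℓ : complexBetti X (2 * 1), IsHeckeLefschetzClass D m ℓ →
        ∀ e : Module.End ℂ (complexBetti X (2 * (m + 1))),
          IsPrimitiveCentralIdempotent (heckeAlgebra D (2 * (m + 1))) e → IsCoreType D ℓ m e →
            ∀ c ∈ primitivePart ℓ m, IsRationalClass c →
              IsOfHodgeType (2 * (m + 1)) X (2 * (m + 1)) (m + 1) (m + 1) c → e c = 0 := by
  sorry

/-! ## The composition (kernel-checked, no `sorry` of its own) -/

/-- **`MiddleThetaSpan` from the six stubs.** Split `c = c₀ + a ∪ ℓ` (`stub_lefschetzSplit`); the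
Lefschetz part `a ∪ ℓ` is a generator of the third typed summand. Decompose `c₀ = Σ_{e ∈ s} e c₀` along
the primitive central idempotents (`stub_heckeIdempotents`, Hodge compatibility `stub_heckeHodgeType`) and run the trichotomy per `e`: Tate type ⇒
`e c₀ ∈ e(P) ⊆ typedSpan` (`stub_singletonSpan`); killed ⇒ the killed conjugate `e'` has `e' c₀ = 0`
(an `(n,n)`-class in `e'(P)`, Hodge compatibility of the Hecke algebra), hence `e c₀ = 0` by the SIEVE
(`stub_sieve` (a), `c₀` rational); core ⇒ `e c₀ = 0` (`stub_coreVanishing`). -/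
theorem MiddleThetaSpan_of : MiddleThetaSpan := by
  intro m X D hm1 hm2 c hc hH
  change c ∈ typedSpan m X D
  obtain ⟨ℓ, hℓ, hsplit⟩ := stub_lefschetzSplit m X D hm1 hm2
  obtain ⟨c₀, a, hc₀Q, hc₀H, hc₀P, haQ, haH, rfl⟩ := hsplit c hc hH
  obtain ⟨s, hprim, hsum⟩ := stub_heckeIdempotents m X D hm1 hm2
  have hstabH := stub_heckeHodgeType m X D hm1 hm2
  refine Submodule.add_mem _ ?_ ?_
  · -- the primitive part, piece by piece
    have hc₀eq : c₀ = ∑ e ∈ s, e c₀ := by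
      rw [← LinearMap.sum_apply, hsum]; rfl
    rw [hc₀eq]
    refine Submodule.sum_mem _ fun e he => ?_
    by_cases hT : IsTateType D ℓ m e
    · -- (T): singleton span
      exact stub_singletonSpan m X D hm1 hm2 ℓ hℓ e (hprim e he) hT (Submodule.mem_map_of_mem hc₀P)
    · by_cases hK : IsKilledType D ℓ m e
      · -- (K): the sieve
        have h0 : e c₀ = 0 := by
          rcases hK with hk | ⟨σ, e', he', hconj, hk⟩
          · exact hk _ (Submodule.mem_map_of_mem hc₀P) (hstabH e (hprim e he).1.1 c₀ hc₀H)
          · have h0' : e' c₀ = 0 :=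
              hk _ (Submodule.mem_map_of_mem hc₀P) (hstabH e' he'.1.1 c₀ hc₀H)
            exact (((stub_sieve m X D hm1 hm2).2 σ e e' hconj).1 c₀ hc₀Q).2 h0'
        rw [h0]
        exact Submodule.zero_mem _
      · -- (C): core vanishing
        have h0 : e c₀ = 0 :=
          stub_coreVanishing m X D hm1 hm2 ℓ hℓ e (hprim e he) ⟨hT, hK⟩ c₀ hc₀P hc₀Q hc₀H
        rw [h0]
        exact Submodule.zero_mem _
  · -- the Lefschetz part lands in the third typed summand
    exact Submodule.mem_sup_right (Submodule.subset_span ⟨a, haQ, haH, ℓ, hℓ.1, rfl⟩)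

end Summit.HodgeConjecture.HodgeConjecture.Cruxes.MiddleThetaSpan.ConjugateDimensionSieve

end
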